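import Mathlib
import Summits.NavierStokesRegularity.NavierStokesRegularity.Theses.SubcriticalEnvelope
import Summits.NavierStokesRegularity.NavierStokesRegularity.Theses.SubOnsagerCeiling
import Summits.NavierStokesRegularity.NavierStokesRegularity.Theorems.SubcriticalEnvelopeViscousTailEnvelopeOrthant
import HarnessLib

/-!
# `SubcriticalEnvelope.ForwardSourceTailEnvelopeKP` (stmt-NavierStokesRegularity-27130, crux A⁺_KP,
rev 8) — the KP ceiling of the sibling route IMPLIES it (glue, `--supports`)

The three KP-class statements of the TL-M2Break cluster filed on 2026-08-28 (rev OW 5 / SOC 3 /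
SE 8) share their binders: spread `R ≥ 1`, scale ratio, a table `α ∈ E₂(R)` that is ORTHANT (Kamke
quasi-positivity) and a KP NETWORK PROPER (diagonal inter-shell feeds,
`a ≠ b → α a b i (0,0,1) = 0`), a source-complete mode set `S`, and honest `ν`-viscous solutions
from one-shell data.  Critic idea-crit-3 (2026-08-28 09:20:40Z §(C)): «27130 is the WEAKEST of the
three and is implied by each of the others at small ε₀ — 27057 ⇒ 27130 (take `C·E₀` as the window
constant, `2θ = 1+η`; the non-negativity hypothesis of 27057 is supplied by OrthantInvariance) … both
are S-difficulty glue lemmas … let SubcriticalEnvelope close through 27130 by glue».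

This file is the first of the two implications:

* `forwardSourceTailEnvelopeKP_of_forwardTailCeilingKP :
    SubOnsagerCeiling.ForwardTailCeilingKP → SubcriticalEnvelope.ForwardSourceTailEnvelopeKP`
  — threshold `εs = 1`; the ceiling's `S`, `θ > 1/2`, `C ≥ 0` give `η = 2θ − 1 > 0` and the
  `T`-independent window constant `C·Σ_i ½X₀ᵢ²`; the sign hypothesis of the ceiling (solutions
  non-negative on shells `≥ 1`) is discharged by Kamke cone invariance
  (`subOnsagerCeiling_orthantInvariance_proof`, item 25508, proved).

So the SE crux 27130 closes the moment SOC's 27057 does (LEAD soc-p2, skeleton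
«kp-shell-barrier»); no parallel structural staffing of 27130 is needed on this line.

HONEST FRAMING: pure logic about Tao-type MODEL lattice statements (rung TL-M2Break); both sides of
the implication are OPEN cruxes; nothing here is a statement about the Navier–Stokes equations and
NS regularity is NOT advanced.
-/

noncomputable section

-- the sub-problem namespace `NavierStokesRegularity.NavierStokesRegularity` is the tree's layout (D-0017)
set_option linter.dupNamespace false

namespace Summit.NavierStokesRegularity.NavierStokesRegularity.Theorems

open Set
open Literature.Analysis.FluidPDE.TaoCascade
open Summit.NavierStokesRegularity.NavierStokesRegularity.Theses

/-- **SOC's KP ceiling implies SE's KP envelope (27057 ⇒ 27130).**  If every orthant KP-proper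
table of every `E₂(R)` carries, at every scale ratio `ε₀ ≤ 1`, a source-complete mode set `S` and a
`ν`-uniform sub-Onsager ceiling `Σ_{k=n..N} Σ_{i∈S} ½X_{i,k}(t)² ≤ C·E₀·(1+ε₀)^{-2θn}` (`θ > 1/2`)
along its honest viscous solutions that are non-negative on shells `≥ 1`
(`ForwardTailCeilingKP`), then the window-wise forward-source envelope `ForwardSourceTailEnvelopeKP`
holds with `εs = 1`, the same `S`, `η = 2θ − 1` and window constant `C·E₀` (uniform in `T` and
`ν`); non-negativity comes from cone invariance.  Pure logic + item 25508.  MODEL lattice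
statement. [this file] -/
theorem forwardSourceTailEnvelopeKP_of_forwardTailCeilingKP
    (h : SubOnsagerCeiling.ForwardTailCeilingKP) :
    SubcriticalEnvelope.ForwardSourceTailEnvelopeKP := by
  intro R hR
  refine ⟨1, one_pos, fun ε₀ hε₀ hle α hα hK hdiag => ?_⟩
  obtain ⟨S, hS, θ, hθ, C, _hC0, H⟩ := h R hR ε₀ hε₀ hle α hα hK hdiag
  refine ⟨S, hS, fun X₀ => ⟨2 * θ - 1, by linarith, fun T _hT =>
    ⟨C * (∑ i : Fin 4, (1 / 2 : ℝ) * X₀ i ^ 2),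
      fun ν hν s hs X hinit hlow hbd hcont hder n N hnN t ht => ?_⟩⟩⟩
  -- Kamke forward invariance of the positive cone: the solution is `≥ 0` on shells `≥ 1`
  have hnonneg : ∀ t ∈ Icc (0 : ℝ) s, ∀ (i : Fin 4) (k : ℤ), 1 ≤ k → 0 ≤ X i k t :=
    subOnsagerCeiling_orthantInvariance_proof ε₀ ν hε₀ hν α hK X₀ s hs.1 X hinit hlow hbd hcont hder
  rw [viscousTailEnvelopeOrthant_exponent]
  exact H ν hν X₀ s hs.1 X hinit hlow hbd hcont hder hnonneg n N hnN t ht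

/-- **Hence SOC's KP ceiling closes the SubcriticalEnvelope route's KP conjunct**: with
`ForwardTailCeilingKP` in hand, the deciding theorem `SubcriticalEnvelope.closes` needs only the
proved smoothing `ForwardSourceSmoothing` and the two declared residuals.  Pure logic.  MODEL
lattice statement; the rung is NOT closed here (three hypotheses remain open). [this file] -/
theorem subcriticalEnvelope_target_of_forwardTailCeilingKP
    (h : SubOnsagerCeiling.ForwardTailCeilingKP)
    (h5 : SubcriticalEnvelope.NonDiagonalOrthantBreak) (h4 : SubcriticalEnvelope.NonOrthantBreak) :
    Summit.NavierStokesRegularity.NavierStokesRegularity.Theses.TaoLadderRungTwoBreak.Target :=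
  SubcriticalEnvelope.closes (forwardSourceTailEnvelopeKP_of_forwardTailCeilingKP h)
    SubcriticalEnvelope.ForwardSourceSmoothing_holds h5 h4

end Summit.NavierStokesRegularity.NavierStokesRegularity.Theorems

end
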